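import Summits.QuantumAdvantage.QuantumAdvantage.Theorems.FeatureShadowClosingA

/-! # Route FeatureShadow (rung F-Q1-odd) — closing theorems, part 2/2: §B routing edge `walkHardFFeat_of_dense`, §C shadow glue, and the BY-NAME closers
of items 27002 `PairGapLaw`, 27001 `WalkHardFFeatOneOdd`, 27003 `PairGapEdgeOdd`, 27004 `FeatOneOfRungOdd`, 27000 `LevelSetEdgeOdd`, 26997 `ShadowGlue`.
Split for landing (≤ 400-line rule) by decomp-qadv-census-1 g5; content VERBATIM from lens-4's FeatureShadowClosing.lean sha256 57f67465 (critic row 21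
CLEARED; writer PB8 closing file of record; lens-4 g3 §A/§B, lens-4 g2 §C). RUNG CURRENCY ONLY — nothing here bears on `QuantumAdvantage`. -/
set_option linter.dupNamespace false

namespace Summit.QuantumAdvantage.QuantumAdvantage.Theorems

open Classical Finset
open Summit.QuantumAdvantage.AdviceFreeQNC0
open Literature.Computability.MetaComplexity Smolensky
open Summit.QuantumAdvantage.QuantumAdvantage.Theses

namespace FeatureShadowClosing

/-! ## §B  The routing edge: dense-table level-set hardness ⟹ P2⁺ -/

/-- **`walkHardFFeat_of_dense`**: level-set hardness of fixed tables firing ≥ 21 cuts (hypothesis `hD`, = the route aside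
`LevelSetFixedHardOdd` at `p` restricted to dense tables) and the landed `walkHardFShots p` give `WalkHardFFeat p`. -/
theorem walkHardFFeat_of_dense (p : ℕ) [Fact p.Prime] (hp3 : p ≠ 3)
    (hD : ∃ η : ℝ, 0 < η ∧ ∀ C : ℕ, ∀ δ : ℝ, 0 < δ → ∃ L₀ : ℕ, ∀ L ≥ L₀,
      ∀ (c : ℕ) (tab : Fin (L + 1) → Bool) (g : (Fin L → Bool) → Bool), HasDegF p g ((Nat.log 2 L) ^ C) →
        21 ≤ (univ.filter fun h : Fin (L + 1) => tab h = true).card →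
        η * ((univ.filter fun z : Fin L → Bool => g z = true).card : ℝ)
          ≤ ((univ.filter fun z : Fin L → Bool => g z = true ∧ ringWinU c (fun h _ => tab h) z = false).card : ℝ)
            + δ * (2 : ℝ) ^ L) :
    WalkHardFFeat p := by
  obtain ⟨θS, hθS, HS⟩ := walkHardFShots p hp3
  obtain ⟨η, hη, HD⟩ := hD
  set η₁ : ℝ := min η 1 with hη₁def
  have hη₁ : 0 < η₁ := lt_min hη one_pos
  have hη₁1 : η₁ ≤ 1 := min_le_right _ _
  have hη₁η : η₁ ≤ η := min_le_left _ _
  have h1θ : 0 < 1 - θS := by linarith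
  have hηθ : 0 < η₁ * (1 - θS) := mul_pos hη₁ h1θ
  refine ⟨1 - η₁ * (1 - θS) / 2, by linarith, fun C K => ?_⟩
  have hδ : (0 : ℝ) < η₁ * (1 - θS) / (2 * 2 ^ K) := div_pos hηθ (by positivity)
  obtain ⟨L₀, hL₀⟩ := HD (C + 1) (η₁ * (1 - θS) / (2 * 2 ^ K)) hδ
  obtain ⟨n₁, hn₁⟩ := HS (C + 1)
  obtain ⟨N₁, hN₁⟩ := DWalk.const_mul_logPow_le' (20 ^ 3) (2 * (C + 1) + 2)
  refine ⟨max (max L₀ n₁) (max N₁ (2 ^ (K + 1))), fun n hn c f tab hdeg => ?_⟩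
  have hnL : L₀ ≤ n := le_trans (le_trans (le_max_left _ _) (le_max_left _ _)) hn
  have hn1 : n₁ ≤ n := le_trans (le_trans (le_max_right _ _) (le_max_left _ _)) hn
  have hN1 : N₁ ≤ n := le_trans (le_trans (le_max_left _ _) (le_max_right _ _)) hn
  have h2K : 2 ^ (K + 1) ≤ n := le_trans (le_trans (le_max_right _ _) (le_max_right _ _)) hn
  have hlogK : K + 1 ≤ Nat.log 2 n := Nat.le_log_of_pow_le (by norm_num) h2K
  have h2n : (0 : ℝ) < (2 : ℝ) ^ n := by positivity
  set y : Fin (n + 1) → (Fin n → Bool) → Bool := fun g u => tab g (fun j => f j u) with hy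
  set φ : (Fin n → Bool) → (Fin K → Bool) := fun u j => f j u with hφ
  set ct : (Fin K → Bool) → ℕ := fun v => (univ.filter fun h : Fin (n + 1) => tab h v = true).card with hct
  set y' : Fin (n + 1) → (Fin n → Bool) → Bool := fun g u => tab g (φ u) && decide (ct (φ u) ≤ 20) with hy'
  -- (1) every function of the feature pattern has degree ≤ K·(log n)^C ≤ (log n)^(C+1)
  have hdegPat : ∀ t : (Fin K → Bool) → Bool, HasDegF p (fun u => t (φ u)) ((Nat.log 2 n) ^ (C + 1)) := by
    intro t
    unfold HasDegF
    have h := GapFibre.ind_mem_lowDeg_of_pattern (F := ZMod p) (L := n) (D := (Nat.log 2 n) ^ C)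
      (univ : Finset (Fin K)) (fun j u => f j u) (fun j _ => hdeg j) (fun u => t (φ u))
      (fun z z' hzz' => by
        have : φ z = φ z' := funext fun j => hzz' j (mem_univ j)
        simp only [this])
    rw [Finset.card_univ, Fintype.card_fin] at h
    refine lowDeg_mono ?_ h
    calc K * (Nat.log 2 n) ^ C ≤ Nat.log 2 n * (Nat.log 2 n) ^ C := Nat.mul_le_mul_right _ (by omega)
      _ = (Nat.log 2 n) ^ (C + 1) := by ring
  have hdeg' : ∀ g, HasDegF p (y' g) ((Nat.log 2 n) ^ (C + 1)) := fun g =>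
    hdegPat (fun v => tab g v && decide (ct v ≤ 20))
  -- (2) the sparse-routed strategy fires ≤ 20 cuts on every input
  have hshots' : ∀ u, (univ.filter fun g : Fin (n + 1) => y' g u = true).card ≤ 20 := by
    intro u
    by_cases hs : ct (φ u) ≤ 20
    · refine le_trans (Finset.card_le_card fun g hg => ?_) hs
      rw [mem_filter] at hg ⊢
      refine ⟨mem_univ _, ?_⟩
      have h2 := hg.2
      rw [hy'] at h2
      simp only [Bool.and_eq_true] at h2
      exact h2.1
    · have hempty : (univ.filter fun g : Fin (n + 1) => y' g u = true) = ∅ := by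
        refine Finset.filter_eq_empty_iff.mpr fun g _ => ?_
        rw [hy']
        simp [hs]
      rw [hempty, Finset.card_empty]; omega
  -- (3) strategies that agree at `u` have the same win bit at `u`
  have hwin_congr : ∀ (y₁ y₂ : Fin (n + 1) → (Fin n → Bool) → Bool) (u : Fin n → Bool),
      (∀ g, y₁ g u = y₂ g u) → ringWinU c y₁ u = ringWinU c y₂ u := by
    intro y₁ y₂ u h
    unfold ringWinU
    have : (univ.filter fun g : Fin (n + 1) => y₁ g u = true ∧ (c + g.val + walkExp u g.val) % 3 ≠ 0) =
        univ.filter fun g : Fin (n + 1) => y₂ g u = true ∧ (c + g.val + walkExp u g.val) % 3 ≠ 0 :=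
      Finset.filter_congr fun g _ => by rw [h g]
    rw [this]
  have hfix : ∀ (u : Fin n → Bool) (v : Fin K → Bool), φ u = v →
      ringWinU c y u = ringWinU c (fun h _ => tab h v) u := by
    intro u v hv
    refine hwin_congr y (fun h _ => tab h v) u fun g => ?_
    rw [hy]
    show tab g (φ u) = tab g v
    rw [hv]
  -- (4) X := #(WIN ∩ sparse classes) ≤ #WIN(y') ≤ θ_S·2ⁿ, and X ≤ #sparse
  have hXsub : (univ.filter fun u : Fin n → Bool => ringWinU c y u = true ∧ ct (φ u) ≤ 20) ⊆
      univ.filter fun u : Fin n → Bool => ringWinU c y' u = true := by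
    intro u hu
    rw [mem_filter] at hu ⊢
    refine ⟨mem_univ _, ?_⟩
    rw [← hu.2.1]
    refine hwin_congr y' y u fun g => ?_
    rw [hy', hy]
    show (tab g (φ u) && decide (ct (φ u) ≤ 20)) = tab g (φ u)
    simp [hu.2.2]
  have hX1 : ((univ.filter fun u : Fin n → Bool => ringWinU c y u = true ∧ ct (φ u) ≤ 20).card : ℝ) ≤
      θS * (2 : ℝ) ^ n := by
    have hy'win := hn₁ n hn1 c 20 y' hdeg' hshots' (hN₁ n hN1)
    have hle : ((univ.filter fun u : Fin n → Bool => ringWinU c y u = true ∧ ct (φ u) ≤ 20).card : ℝ) ≤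
        ((univ.filter fun u : Fin n → Bool => ringWinU c y' u = true).card : ℝ) := by
      exact_mod_cast Finset.card_le_card hXsub
    exact le_trans hle hy'win
  have hX2 : (univ.filter fun u : Fin n → Bool => ringWinU c y u = true ∧ ct (φ u) ≤ 20).card ≤
      (univ.filter fun u : Fin n → Bool => ct (φ u) ≤ 20).card :=
    Finset.card_le_card fun u hu => by
      rw [mem_filter] at hu ⊢; exact ⟨hu.1, hu.2.2⟩
  -- (5) WIN and the cube split by sparse / dense pattern
  have hWsplit := Finset.card_filter_add_card_filter_not
    (s := univ.filter fun u : Fin n → Bool => ringWinU c y u = true) (p := fun u => ct (φ u) ≤ 20)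
  rw [Finset.filter_filter, Finset.filter_filter] at hWsplit
  have hABsplit := Finset.card_filter_add_card_filter_not
    (s := (univ : Finset (Fin n → Bool))) (p := fun u => ct (φ u) ≤ 20)
  rw [card_univ, Fintype.card_fun, Fintype.card_bool, Fintype.card_fin] at hABsplit
  -- (6) dense cells
  set DV : Finset (Fin K → Bool) := univ.filter fun v => ¬ ct v ≤ 20 with hDV
  have hdegv : ∀ v : Fin K → Bool, HasDegF p (fun u => decide (φ u = v)) ((Nat.log 2 n) ^ (C + 1)) :=
    fun v => hdegPat (fun w => decide (w = v))
  have hcellD : ∀ v ∈ DV,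
      η * ((univ.filter fun u : Fin n → Bool => decide (φ u = v) = true).card : ℝ) ≤
        ((univ.filter fun u : Fin n → Bool => decide (φ u = v) = true ∧
            ringWinU c (fun h _ => tab h v) u = false).card : ℝ) +
          η₁ * (1 - θS) / (2 * 2 ^ K) * (2 : ℝ) ^ n := by
    intro v hv
    have h21 : 21 ≤ (univ.filter fun h : Fin (n + 1) => tab h v = true).card := by
      rw [hDV, mem_filter] at hv
      have h2 := hv.2
      simp only [hct] at h2
      omega
    exact hL₀ n hnL c (fun h => tab h v) (fun u => decide (φ u = v)) (hdegv v) h21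
  have hcellWL : ∀ v : Fin K → Bool,
      ((univ.filter fun u : Fin n → Bool => decide (φ u = v) = true ∧ ringWinU c y u = true).card : ℝ) +
        ((univ.filter fun u : Fin n → Bool => decide (φ u = v) = true ∧
            ringWinU c (fun h _ => tab h v) u = false).card : ℝ) =
        ((univ.filter fun u : Fin n → Bool => decide (φ u = v) = true).card : ℝ) := by
    intro v
    have hsplit := Finset.card_filter_add_card_filter_not
      (s := univ.filter fun u : Fin n → Bool => decide (φ u = v) = true) (p := fun u => ringWinU c y u = true)
    rw [Finset.filter_filter, Finset.filter_filter] at hsplit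
    have hset : (univ.filter fun u : Fin n → Bool => decide (φ u = v) = true ∧ ¬ ringWinU c y u = true) =
        univ.filter fun u : Fin n → Bool =>
          decide (φ u = v) = true ∧ ringWinU c (fun h _ => tab h v) u = false := by
      refine Finset.filter_congr fun u _ => ?_
      constructor
      · rintro ⟨hv, hw⟩
        refine ⟨hv, ?_⟩
        rw [← hfix u v (by rwa [decide_eq_true_eq] at hv)]
        simpa using hw
      · rintro ⟨hv, hw⟩
        refine ⟨hv, ?_⟩
        rw [← hfix u v (by rwa [decide_eq_true_eq] at hv)] at hw
        simpa using hw
    rw [hset] at hsplit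
    exact_mod_cast hsplit
  have hYsum : ((univ.filter fun u : Fin n → Bool => ringWinU c y u = true ∧ ¬ ct (φ u) ≤ 20).card : ℝ) =
      ∑ v ∈ DV, ((univ.filter fun u : Fin n → Bool =>
        decide (φ u = v) = true ∧ ringWinU c y u = true).card : ℝ) := by
    have h := Finset.card_eq_sum_card_fiberwise (f := φ)
      (s := univ.filter fun u : Fin n → Bool => ringWinU c y u = true ∧ ¬ ct (φ u) ≤ 20) (t := DV)
      (fun u hu => by
        rw [Finset.mem_coe, mem_filter] at hu
        rw [Finset.mem_coe, hDV, mem_filter]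
        exact ⟨mem_univ _, hu.2.2⟩)
    rw [h, Nat.cast_sum]
    refine Finset.sum_congr rfl fun v hvD => ?_
    rw [Nat.cast_inj, Finset.filter_filter]
    congr 1
    refine Finset.filter_congr fun u _ => ?_
    rw [decide_eq_true_eq]
    constructor
    · rintro ⟨⟨hw, _⟩, hv⟩; exact ⟨hv, hw⟩
    · rintro ⟨hv, hw⟩
      refine ⟨⟨hw, ?_⟩, hv⟩
      rw [hDV, mem_filter] at hvD
      rw [hv]; exact hvD.2
  have hBsum : ((univ.filter fun u : Fin n → Bool => ¬ ct (φ u) ≤ 20).card : ℝ) =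
      ∑ v ∈ DV, ((univ.filter fun u : Fin n → Bool => decide (φ u = v) = true).card : ℝ) := by
    have h := Finset.card_eq_sum_card_fiberwise (f := φ)
      (s := univ.filter fun u : Fin n → Bool => ¬ ct (φ u) ≤ 20) (t := DV)
      (fun u hu => by
        rw [Finset.mem_coe, mem_filter] at hu
        rw [Finset.mem_coe, hDV, mem_filter]
        exact ⟨mem_univ _, hu.2⟩)
    rw [h, Nat.cast_sum]
    refine Finset.sum_congr rfl fun v hvD => ?_
    rw [Nat.cast_inj, Finset.filter_filter]
    congr 1
    refine Finset.filter_congr fun u _ => ?_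
    rw [decide_eq_true_eq]
    constructor
    · rintro ⟨_, hv⟩; exact hv
    · intro hv
      refine ⟨?_, hv⟩
      rw [hDV, mem_filter] at hvD
      rw [hv]; exact hvD.2
  have hcell : ∀ v ∈ DV,
      η₁ * ((univ.filter fun u : Fin n → Bool => decide (φ u = v) = true).card : ℝ) +
        ((univ.filter fun u : Fin n → Bool => decide (φ u = v) = true ∧ ringWinU c y u = true).card : ℝ) ≤
        ((univ.filter fun u : Fin n → Bool => decide (φ u = v) = true).card : ℝ) +
          η₁ * (1 - θS) / (2 * 2 ^ K) * (2 : ℝ) ^ n := by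
    intro v hvD
    have h1 := hcellD v hvD
    have h2 := hcellWL v
    have hUv : (0 : ℝ) ≤ ((univ.filter fun u : Fin n → Bool => decide (φ u = v) = true).card : ℝ) := by
      positivity
    have h3 : η₁ * ((univ.filter fun u : Fin n → Bool => decide (φ u = v) = true).card : ℝ) ≤
        η * ((univ.filter fun u : Fin n → Bool => decide (φ u = v) = true).card : ℝ) :=
      mul_le_mul_of_nonneg_right hη₁η hUv
    linarith
  have hE0 : (0 : ℝ) ≤ η₁ * (1 - θS) / (2 * 2 ^ K) * (2 : ℝ) ^ n := le_of_lt (mul_pos hδ h2n)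
  have hsum : η₁ * ((univ.filter fun u : Fin n → Bool => ¬ ct (φ u) ≤ 20).card : ℝ) +
      ((univ.filter fun u : Fin n → Bool => ringWinU c y u = true ∧ ¬ ct (φ u) ≤ 20).card : ℝ) ≤
      ((univ.filter fun u : Fin n → Bool => ¬ ct (φ u) ≤ 20).card : ℝ) +
        (2 : ℝ) ^ K * (η₁ * (1 - θS) / (2 * 2 ^ K) * (2 : ℝ) ^ n) := by
    rw [hBsum, hYsum, Finset.mul_sum, ← Finset.sum_add_distrib]
    refine le_trans (Finset.sum_le_sum hcell) ?_
    rw [Finset.sum_add_distrib, Finset.sum_const, nsmul_eq_mul]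
    have hDVcard : (DV.card : ℝ) ≤ (2 : ℝ) ^ K := by
      have : DV.card ≤ Fintype.card (Fin K → Bool) := Finset.card_le_univ _
      rw [Fintype.card_fun, Fintype.card_bool, Fintype.card_fin] at this
      exact_mod_cast this
    nlinarith [mul_le_mul_of_nonneg_right hDVcard hE0]
  -- (7) arithmetic
  have hW : ((univ.filter fun u : Fin n → Bool => ringWinU c y u = true).card : ℝ) =
      ((univ.filter fun u : Fin n → Bool => ringWinU c y u = true ∧ ct (φ u) ≤ 20).card : ℝ) +
      ((univ.filter fun u : Fin n → Bool => ringWinU c y u = true ∧ ¬ ct (φ u) ≤ 20).card : ℝ) := by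
    exact_mod_cast hWsplit.symm
  have hAB : ((univ.filter fun u : Fin n → Bool => ct (φ u) ≤ 20).card : ℝ) +
      ((univ.filter fun u : Fin n → Bool => ¬ ct (φ u) ≤ 20).card : ℝ) = (2 : ℝ) ^ n := by
    exact_mod_cast hABsplit
  have hX2r : ((univ.filter fun u : Fin n → Bool => ringWinU c y u = true ∧ ct (φ u) ≤ 20).card : ℝ) ≤
      ((univ.filter fun u : Fin n → Bool => ct (φ u) ≤ 20).card : ℝ) := by exact_mod_cast hX2
  have hE : (2 : ℝ) ^ K * (η₁ * (1 - θS) / (2 * 2 ^ K) * (2 : ℝ) ^ n) = η₁ * (1 - θS) / 2 * (2 : ℝ) ^ n := by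
    have h2K : (2 : ℝ) ^ K ≠ 0 := by positivity
    field_simp
  rw [hE] at hsum
  have p1 := mul_le_mul_of_nonneg_left hX2r (show (0 : ℝ) ≤ 1 - η₁ by linarith)
  have p2 := mul_le_mul_of_nonneg_left hX1 hη₁.le
  have p3 : η₁ * ((univ.filter fun u : Fin n → Bool => ct (φ u) ≤ 20).card : ℝ) +
      η₁ * ((univ.filter fun u : Fin n → Bool => ¬ ct (φ u) ≤ 20).card : ℝ) = η₁ * (2 : ℝ) ^ n := by
    rw [← mul_add, hAB]
  rw [hW]
  linarith


end FeatureShadowClosing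

namespace FeatureShadowClosing

/-! ## §C  The shadow glue (lens-4 g2, node FeatureShadow v3.4: `ringWinU_iff_counts`, `ringWinU_eq_of_shadow`, `target_of_pieces`) -/

section Glue
variable {n : ℕ}

/-- the win bit from the three label counts (cf. `ringWinU_iff_regCount`, re-proved here to keep the imports thesis-clean). -/
theorem ringWinU_iff_counts (c : ℕ) (y : Fin (n + 1) → (Fin n → Bool) → Bool) (u : Fin n → Bool) :
    ringWinU c y u = true ↔
      ((Finset.univ.filter fun g : Fin (n + 1) => y g u = true ∧ (g.val + wtPrefix u g.val) % 3 = 0).card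
        + (Finset.univ.filter fun g : Fin (n + 1) => y g u = true ∧ (g.val + wtPrefix u g.val) % 3 = 1).card
        + (Finset.univ.filter fun g : Fin (n + 1) => y g u = true ∧ (g.val + wtPrefix u g.val) % 3 = 2).card
        + (Finset.univ.filter fun g : Fin (n + 1) =>
            y g u = true ∧ (g.val + wtPrefix u g.val) % 3 = (3 - (c + wt u) % 3) % 3).card) % 2 = 1 := by
  set e₀ := (3 - (c + wt u) % 3) % 3 with he₀
  have hfired : (univ.filter fun g : Fin (n + 1) => y g u = true).card
      = (Finset.univ.filter fun g : Fin (n + 1) => y g u = true ∧ (g.val + wtPrefix u g.val) % 3 = 0).card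
        + (Finset.univ.filter fun g : Fin (n + 1) => y g u = true ∧ (g.val + wtPrefix u g.val) % 3 = 1).card
        + (Finset.univ.filter fun g : Fin (n + 1) => y g u = true ∧ (g.val + wtPrefix u g.val) % 3 = 2).card := by
    rw [card_eq_sum_card_fiberwise (f := fun g : Fin (n + 1) => (g.val + wtPrefix u g.val) % 3) (t := range 3)
      (fun g _ => mem_range.mpr (Nat.mod_lt _ (by norm_num)))]
    simp only [sum_range_succ, sum_range_zero, zero_add, filter_filter]
  have hlive : (univ.filter fun g : Fin (n + 1) => y g u = true ∧ (c + g.val + walkExp u g.val) % 3 ≠ 0)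
      = (univ.filter fun g : Fin (n + 1) => y g u = true).filter
          fun g => ¬ (g.val + wtPrefix u g.val) % 3 = e₀ := by
    ext g
    simp only [mem_filter, mem_univ, true_and, walkExp]
    constructor
    · rintro ⟨h1, h2⟩; exact ⟨h1, by omega⟩
    · rintro ⟨h1, h2⟩; exact ⟨h1, by omega⟩
  have hsplit := card_filter_add_card_filter_not (s := univ.filter fun g : Fin (n + 1) => y g u = true)
    (fun g => (g.val + wtPrefix u g.val) % 3 = e₀)
  have he : ((univ.filter fun g : Fin (n + 1) => y g u = true).filter fun g => (g.val + wtPrefix u g.val) % 3 = e₀).card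
      = (Finset.univ.filter fun g : Fin (n + 1) => y g u = true ∧ (g.val + wtPrefix u g.val) % 3 = e₀).card := by
    rw [filter_filter]
  rw [he, hfired] at hsplit
  unfold ringWinU
  rw [decide_eq_true_iff, hlive]
  constructor <;> intro h <;> omega

/-- **shadow lemma**: two strategies whose registers agree mod 2 up to a common shift win on the same inputs. -/
theorem ringWinU_eq_of_shadow (c : ℕ) (y y' : Fin (n + 1) → (Fin n → Bool) → Bool) (u : Fin n → Bool)
    (h : ∀ e ∈ Finset.range 3, ∀ e' ∈ Finset.range 3,
      ((Finset.univ.filter fun g : Fin (n + 1) => y g u = true ∧ (g.val + wtPrefix u g.val) % 3 = e).card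
        + (Finset.univ.filter fun g : Fin (n + 1) => y' g u = true ∧ (g.val + wtPrefix u g.val) % 3 = e).card) % 2
      = ((Finset.univ.filter fun g : Fin (n + 1) => y g u = true ∧ (g.val + wtPrefix u g.val) % 3 = e').card
        + (Finset.univ.filter fun g : Fin (n + 1) => y' g u = true ∧ (g.val + wtPrefix u g.val) % 3 = e').card) % 2) :
    ringWinU c y u = ringWinU c y' u := by
  have h3 : (3 - (c + wt u) % 3) % 3 ∈ Finset.range 3 := mem_range.mpr (Nat.mod_lt _ (by norm_num))
  have h01 := h 0 (by simp) 1 (by simp)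
  have h02 := h 0 (by simp) 2 (by simp)
  have h0e := h 0 (by simp) _ h3
  rw [Bool.eq_iff_iff, ringWinU_iff_counts, ringWinU_iff_counts]
  omega

end Glue

/-- **Glue** (item 26997 `FeatureShadow.ShadowGlue`): the two pieces `NearPerfectFeatureShadow` and `FeatureRungOdd` give the Target. -/
theorem target_of_pieces (h₁ : FeatureShadow.NearPerfectFeatureShadow) (h₂ : FeatureShadow.FeatureRungOdd) :
    FeatureShadow.Target := by
  intro p _ hp
  obtain ⟨θ₀, hθ₀, H₂⟩ := h₂ p hp
  have hq : 0 < (1 - θ₀) / 4 := by linarith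
  obtain ⟨ε, hε, H₁⟩ := h₁ p hp ((1 - θ₀) / 4) hq
  refine ⟨max (θ₀ + (1 - θ₀) / 4) (1 - ε), max_lt (by linarith) (by linarith), fun C => ?_⟩
  obtain ⟨C', K, n₁, H₁C⟩ := H₁ C
  obtain ⟨n₂, H₂C⟩ := H₂ C' K
  refine ⟨max n₁ n₂, fun n hn c y hy => ?_⟩
  have h2 : (0 : ℝ) ≤ (2 : ℝ) ^ n := by positivity
  by_cases hwin : ((Finset.univ.filter fun u : Fin n → Bool => ringWinU c y u = true).card : ℝ) ≤ (1 - ε) * (2 : ℝ) ^ n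
  · exact hwin.trans (mul_le_mul_of_nonneg_right (le_max_right _ _) h2)
  · rw [not_le] at hwin
    obtain ⟨f, hf, tab, hExc⟩ := H₁C n (le_of_max_le_left hn) c y hy hwin.le
    have hmodel := H₂C n (le_of_max_le_right hn) c f tab hf
    -- WIN(y) ⊆ Exc ∪ WIN(model)
    set Exc := Finset.univ.filter fun u : Fin n → Bool => ¬ (∀ e ∈ Finset.range 3, ∀ e' ∈ Finset.range 3,
            ((Finset.univ.filter fun g : Fin (n + 1) => y g u = true ∧ (g.val + wtPrefix u g.val) % 3 = e).card
              + (Finset.univ.filter fun g : Fin (n + 1) =>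
                  tab g (fun j => f j u) = true ∧ (g.val + wtPrefix u g.val) % 3 = e).card) % 2
            = ((Finset.univ.filter fun g : Fin (n + 1) => y g u = true ∧ (g.val + wtPrefix u g.val) % 3 = e').card
              + (Finset.univ.filter fun g : Fin (n + 1) =>
                  tab g (fun j => f j u) = true ∧ (g.val + wtPrefix u g.val) % 3 = e').card) % 2) with hExcDef
    set WinM := Finset.univ.filter fun u : Fin n → Bool => ringWinU c (fun g u => tab g (fun j => f j u)) u = true
      with hWinMDef
    have hsub : (Finset.univ.filter fun u : Fin n → Bool => ringWinU c y u = true) ⊆ Exc ∪ WinM := by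
      intro u hu
      rw [mem_filter] at hu
      rw [mem_union]
      by_cases hE : u ∈ Exc
      · exact Or.inl hE
      · right
        rw [hExcDef, mem_filter, not_and, not_not] at hE
        have hX := hE (mem_univ _)
        rw [hWinMDef, mem_filter]
        refine ⟨mem_univ _, ?_⟩
        rw [← ringWinU_eq_of_shadow c y (fun g u => tab g (fun j => f j u)) u hX]
        exact hu.2
    have hle := (Finset.card_le_card hsub).trans (Finset.card_union_le _ _)
    have hle' : (((Finset.univ.filter fun u : Fin n → Bool => ringWinU c y u = true).card : ℕ) : ℝ)
        ≤ (Exc.card : ℝ) + (WinM.card : ℝ) := by exact_mod_cast hle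
    calc (((Finset.univ.filter fun u : Fin n → Bool => ringWinU c y u = true).card : ℕ) : ℝ)
        ≤ (Exc.card : ℝ) + (WinM.card : ℝ) := hle'
      _ ≤ (1 - θ₀) / 4 * (2 : ℝ) ^ n + θ₀ * (2 : ℝ) ^ n := add_le_add hExc hmodel
      _ = (θ₀ + (1 - θ₀) / 4) * (2 : ℝ) ^ n := by ring
      _ ≤ max (θ₀ + (1 - θ₀) / 4) (1 - ε) * (2 : ℝ) ^ n := mul_le_mul_of_nonneg_right (le_max_left _ _) h2


end FeatureShadowClosing

/-! ## Closing theorems, BY NAME of the route decls -/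


/-- closes item stmt-QuantumAdvantage-27001 `FeatureShadow.WalkHardFFeatOneOdd` (K = 1 rung of P2⁺, every prime p ≥ 5). -/
theorem featureShadow_walkHardFFeatOneOdd : FeatureShadow.WalkHardFFeatOneOdd :=
  fun p _ hp => FeatureShadowClosing.walkHardFFeatOne_holds p (by omega)

/-- closes item stmt-QuantumAdvantage-27003 `FeatureShadow.PairGapEdgeOdd`. -/
theorem featureShadow_pairGapEdgeOdd : FeatureShadow.PairGapEdgeOdd := fun _ => featureShadow_walkHardFFeatOneOdd

/-- closes item stmt-QuantumAdvantage-27004 `FeatureShadow.FeatOneOfRungOdd`. -/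
theorem featureShadow_featOneOfRungOdd : FeatureShadow.FeatOneOfRungOdd := fun _ => featureShadow_walkHardFFeatOneOdd

/-- closes item stmt-QuantumAdvantage-27000 `FeatureShadow.LevelSetEdgeOdd` (through the dense half of `LevelSetFixedHardOdd` only). -/
theorem featureShadow_levelSetEdgeOdd : FeatureShadow.LevelSetEdgeOdd := by
  intro hL p _ hp
  obtain ⟨η, hη, H⟩ := hL p hp
  refine FeatureShadowClosing.walkHardFFeat_of_dense p (by omega) ⟨η, hη, fun C δ hδ => ?_⟩
  obtain ⟨L₀, hL₀⟩ := H C δ hδ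
  exact ⟨L₀, fun L hLL c tab g hg _ => hL₀ L hLL c tab g hg⟩

/-- closes item stmt-QuantumAdvantage-26997 `FeatureShadow.ShadowGlue` (lens-4 g2's glue). -/
theorem featureShadow_shadowGlue : FeatureShadow.ShadowGlue := FeatureShadowClosing.target_of_pieces

end Summit.QuantumAdvantage.QuantumAdvantage.Theorems
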